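import Summits.ABC.ABC.Theses.DefiniteXi
import HarnessLib

/-!
# Stub-ideation k2, generation 9 (FAMILY 2 — RESHAPE) — `stub_primeToSixDegreeBound` (P6)
# crux `DefiniteXi.SteinbergCore` (stmt-ABC-15024), line `p6_tamagawa_split`

Elaboration companion of `STUB-IDEAS-stub_primeToSixDegreeBound-2.md` (gen 9). Imports the ROUTE FILE ONLY:
tonight the crux work-file modules (`STUB_IDEAS_…_1_g2`, `…_1_g4`) and the `DefiniteXiSteinbergCorePrimeRung`
closure are `remote:stale … unbuilt` on the farm (not wrong — unbuilt), so the by-name helpers H1/H2/H3 of the MD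
are cited, not re-imported:
* `Stub` = the registered stub verbatim (= `P6TamagawaSplit.stub_primeToSixDegreeBound`'s statement
  = `StubIdeas1G2.P6` = `StubIdeas1G4.P6`, definitionally).
* H0 `FreyDegreeBound → Stub` — local copy of the tree's
  `Summit.ABC.ABC.Theorems.SteinbergCorePrimeRung.primeToSixDegreeBound_of_freyDegreeBound` (p162616).
* H1+H2 `ABC → FreyDegreeBound / Stub` mod four named facts: `StubIdeas1G2.freyDegreeBound_of_ABC_of_facts`,
  `StubIdeas1G2.p6_of_ABC_of_facts` (k1 g2 work-file).  H3 (Y3, documentation): `StubIdeas1G4.p6_of_murtyPastenConj44`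
  over the tree row `Summit.ABC.Analytic.MurtyPastenConj44` / `anemicCongruenceNumber` (k1 g4 work-file).
* `denominator_dvd_prod_witnesses` — the commutative-algebra kernel of the gen-9 remark Y3(a): in an order
  `T ⊂ ℤ × R` the "denominator of the idempotent `(1,0)`" divides the product of pairwise congruence witnesses,
  so a super-polynomial PRODUCT of congruence moduli (k2 g3 `EtaProductSuperpoly`) says nothing against a
  polynomial DENOMINATOR `n'_f` (Murty–Pasten Conj. 4.4).
-/

set_option linter.dupNamespace false

namespace Summit.ABC.ABC.Cruxes.SteinbergCore.StubIdeas2G9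

open Literature.NumberTheory.EllipticCurves Literature.NumberTheory.EllipticCurves.ModularForms
open Summit.ABC.ABC.Theses.DefiniteXi

/-- The registered stub, verbatim. [folklore] -/
def Stub : Prop :=
  ∀ ε : ℝ, 0 < ε → ∃ C : ℝ, ∀ a b : ℤ, IsCoprime a b → a * b * (a + b) ≠ 0 → ∀ (N : ℕ) [NeZero N], (Literature.NumberTheory.EllipticCurves.freyCurve a b).conductorNorm ℤ = N → ∀ D : Literature.NumberTheory.EllipticCurves.ModularForms.ModularParametrizationData (Literature.NumberTheory.EllipticCurves.freyCurve a b) N, (∀ D' : Literature.NumberTheory.EllipticCurves.ModularForms.ModularParametrizationData (Literature.NumberTheory.EllipticCurves.freyCurve a b) N, D.deg ≤ D'.deg) → ((D.deg / (ordProj[2] D.deg * ordProj[3] D.deg) : ℕ) : ℝ) ≤ C * (N : ℝ) ^ (2 + ε)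

/-- **H0** (local copy of the tree's `SteinbergCorePrimeRung.primeToSixDegreeBound_of_freyDegreeBound`, p162616):
the route target gives the stub, `cps(deg D_min) ≤ deg D_min ≤ deg D₀ ≤ C·N^{2+ε}`. [folklore] -/
theorem stub_of_freyDegreeBound (hX : FreyDegreeBound) : Stub := by
  intro ε hε
  obtain ⟨C, hC⟩ := hX ε hε
  refine ⟨C, fun a b hab h0 N _ hN D hDmin => ?_⟩
  obtain ⟨D₀, hD₀⟩ := hC a b hab h0 N hN
  have h1 : ((D.deg / (ordProj[2] D.deg * ordProj[3] D.deg) : ℕ) : ℝ) ≤ (D.deg : ℝ) := by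
    exact_mod_cast Nat.div_le_self _ _
  have h2 : (D.deg : ℝ) ≤ (D₀.deg : ℝ) := by exact_mod_cast hDmin D₀
  exact h1.trans (h2.trans hD₀)

/-- **Y3(a), the algebra kernel.** In an order `T ⊆ ℤ × R` (think `T = 𝕋'_N ⊆ ℤ × ∏_g 𝒪_g`, first factor the
rational newform `f`), if for each `i` a witness `(m i, r i) ∈ T` is given and the second coordinates multiply
to `0` (each `r i` kills the `i`-th factor of `∏_g 𝒪_g`), then `(∏ m i, 0) ∈ T`: the denominator ideal
`{n : (n,0) ∈ T}` contains the PRODUCT of the pairwise congruence witnesses. Hence `n'_f ∣ ∏_g η_f(g)`, and a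
super-polynomial product (k2 g3 `EtaProductSuperpoly`) does not refute a polynomial `n'_f`. [folklore] -/
theorem denominator_dvd_prod_witnesses {R : Type*} [CommRing R] (T : Subring (ℤ × R)) {ι : Type*}
    (s : Finset ι) (m : ι → ℤ) (r : ι → R) (hmem : ∀ i ∈ s, ((m i, r i) : ℤ × R) ∈ T)
    (hzero : ∏ i ∈ s, r i = 0) : ((∏ i ∈ s, m i, (0 : R)) : ℤ × R) ∈ T := by
  have h : (∏ i ∈ s, ((m i, r i) : ℤ × R)) ∈ T := Subring.prod_mem T (fun i hi => hmem i hi)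
  have heq : (∏ i ∈ s, ((m i, r i) : ℤ × R)) = ((∏ i ∈ s, m i, (0 : R)) : ℤ × R) := by
    ext
    · simp [Prod.fst_prod]
    · simp [Prod.snd_prod, hzero]
  rw [heq] at h
  exact h

/-- **Y3(a), the other side.** The denominator ideal is an ideal of `ℤ`: if `(n,0) ∈ T` then `(k*n, 0) ∈ T`;
together with the projections `ℤ × ∏_g 𝒪_g → ℤ × 𝒪_g` this gives `lcm_g η_f(g) ∣ n'_f`. [folklore] -/
theorem mul_mem_denominator {R : Type*} [CommRing R] (T : Subring (ℤ × R)) (n k : ℤ)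
    (h : ((n, (0 : R)) : ℤ × R) ∈ T) : ((k * n, (0 : R)) : ℤ × R) ∈ T := by
  have hk : ((k, (k : R)) : ℤ × R) ∈ T := by
    have : ((k, (k : R)) : ℤ × R) = ((k : ℤ × R)) := by ext <;> simp
    rw [this]; exact intCast_mem T k
  have := Subring.mul_mem T hk h
  simpa using this

end Summit.ABC.ABC.Cruxes.SteinbergCore.StubIdeas2G9
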